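import Literature.AnabelianGeometry.SemiGraphs.TemperedCosetTowerNoFixedBranchPair
import Literature.AnabelianGeometry.SemiGraphs.TemperedBranchPairOfTower
import Literature.AnabelianGeometry.SemiGraphs.TemperedPiFibreFaithful
import HarnessLib

/-!
# [SemiAnbd] Thm 5.4 (i) p. 66 / Thm 3.7 (iii) p. 41: the capstone binder `hnobpNCpt` at the canonical coset
# tower, modulo the vertex-faithfulness input (I0v) only (proof-only)

Mochizuki, *Semi-graphs of anabelioids*, Publ. RIMS **42** (2006), §3, proof of Thm. 3.7 (iii) p. 41; §5
Thm. 5.4 (i) p. 66 [cite: MochizukiSemiAnbd2006, Thm 3.7(iii) p.41].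

PROOF-ONLY (cell abc-iut, layer L3, row «T54-B hnobpNCpt-PRODUCER», completion; seat abc-iut-w4-d083).
`hnobpNCpt_cosetTower` (`TemperedCosetTowerNoFixedBranchPair.lean`) produces the capstone binder from the
orbit-level (I4′)_cpt text; abc-iut-L3-t11's `GaloisLevelData.stabBranchPairCpt'_ofTower'`
(`TemperedBranchPairOfTower.lean`) produces that text for ANY Galois tower and any chart acting through a
continuous injective `ρ`, modulo the vertex-faithfulness input (I0v) `hfaithV` («`𝒢_v` acts faithfully on the
fibres of the tower»).  Composing at the canonical tower (`ρ = id`):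
**`hnobpNCpt_cosetTower_of_faithV`** — the binder `hnobpNCpt` of `ArithLevelDataCpt.ofCosetTowerC` at
`𝒢.galoisLevelData h36`, `𝒢.temperedPiChart h36`, `L n := ker π_n`, modulo (I0v) alone;
**`hnobpNCpt_cosetTower_holds`** (v2, appended) — UNCONDITIONAL: (I0v) is abc-iut-L3-t6's theorem
`galoisLevelData_faithfulV` (`TemperedPiFibreFaithful.lean`).
Nothing here bears on [IUTchIII] Cor. 3.12; typed ≠ proved.
-/

namespace Literature.AnabelianGeometry.SemiGraphs

namespace ProfiniteSemiGraph

open CategoryTheory Topology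

universe u v

variable {𝒢 : ProfiniteSemiGraph.{u}}

/-- **The capstone binder `hnobpNCpt` at the canonical coset tower, modulo (I0v) alone**: for the Galois
tower `𝒢.galoisLevelData h36` with `π₁^temp(𝒢) = lim_n Gal(𝒢_{∞,n}/𝒢)` (chart `𝒢.temperedPiChart h36`), the
presentation `piPresentation T R`, the finite coset levels `ker π_n` and an arithmetic group `E ⊇ ι(π₁^temp(𝒢))`
acting compatibly (`hP`, `hN`, `hιΦ`, `hισ`): if every vertex group `𝒢_v` acts faithfully on the fibres of
the tower (`hfaithV`, input (I0v)), then no compact `C ≠ 1` fixes, through the arithmetic actions, a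
compatible system of a vertex with two distinct abutting branches of the coset semi-graphs
(`hnobpNCpt_cosetTower` ∘ abc-iut-L3-t11's `stabBranchPairCpt'_ofTower'` at `ρ = id`).
[cite: MochizukiSemiAnbd2006, Thm 5.4 (i), p. 66] -/
theorem hnobpNCpt_cosetTower_of_faithV (h36 : 𝒢.Prop36Hypotheses) (h37 : 𝒢.Thm37Hypotheses)
    (hconn : ∀ (n : ℕ) (p q : ((𝒢.galoisLevelData h36).S n).Point),
      ((𝒢.galoisLevelData h36).S n).SameComponent p q)
    (T : ∀ w : 𝒢.graph.Vertex, (𝒢.galoisLevelData h36).PointSeq h36.isCountable w)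
    (R : SemiGraph.RefBranches 𝒢.graph) {E : Type v} [Group E]
    {Φ : E →* MulAut (𝒢.temperedPiChart h36).G} {σ : E →* Aut 𝒢.graph}
    (hP : ((𝒢.galoisLevelData h36).piPresentation h36.isCountable T R).IsArithCompatible Φ σ)
    (hN : ∀ (n : ℕ) (e : E) (x : (𝒢.temperedPiChart h36).G),
      x ∈ ((𝒢.galoisLevelData h36).piLevelAut h36.isCountable hconn n).ker →
        Φ e x ∈ ((𝒢.galoisLevelData h36).piLevelAut h36.isCountable hconn n).ker)
    (ι : (𝒢.temperedPiChart h36).G →* E) (hιΦ : ∀ g, Φ (ι g) = MulAut.conj g) (hισ : ∀ g, σ (ι g) = 1)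
    (hfaithV : ∀ (v : 𝒢.graph.Vertex) (h : 𝒢.Gv v),
      (∀ (n : ℕ) (x : (((𝒢.galoisLevelData h36).S n).SV v).obj.V),
        (((𝒢.galoisLevelData h36).S n).SV v).obj.ρ h x = x) → h = 1) :
    ∀ (C : Subgroup (𝒢.temperedPiChart h36).G), IsCompact (C : Set (𝒢.temperedPiChart h36).G) →
      ∀ (j₀ : ℕ) (w : ∀ i : {i : ℕ // j₀ ≤ i},
        (((𝒢.galoisLevelData h36).piPresentation h36.isCountable T R).cosetGraph
          ((𝒢.galoisLevelData h36).piLevelAut h36.isCountable hconn i.1).ker).Vertex)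
      (β β' : ∀ i : {i : ℕ // j₀ ≤ i},
        (((𝒢.galoisLevelData h36).piPresentation h36.isCountable T R).cosetGraph
          ((𝒢.galoisLevelData h36).piLevelAut h36.isCountable hconn i.1).ker).Branch),
      (∀ i, β i ≠ β' i ∧
        (((𝒢.galoisLevelData h36).piPresentation h36.isCountable T R).cosetGraph
          ((𝒢.galoisLevelData h36).piLevelAut h36.isCountable hconn i.1).ker).abuts (β i) = some (w i) ∧
        (((𝒢.galoisLevelData h36).piPresentation h36.isCountable T R).cosetGraph
          ((𝒢.galoisLevelData h36).piLevelAut h36.isCountable hconn i.1).ker).abuts (β' i) = some (w i)) →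
      (∀ ⦃i i' : {i : ℕ // j₀ ≤ i}⦄ (h : i.1 ≤ i'.1),
        (((𝒢.galoisLevelData h36).piPresentation h36.isCountable T R).cosetGraphTrans
            ((𝒢.galoisLevelData h36).ker_piLevelAut_anti h36.isCountable hconn h)).vertexMap (w i') = w i ∧
        (((𝒢.galoisLevelData h36).piPresentation h36.isCountable T R).cosetGraphTrans
            ((𝒢.galoisLevelData h36).ker_piLevelAut_anti h36.isCountable hconn h)).branchMap (β i') = β i ∧
        (((𝒢.galoisLevelData h36).piPresentation h36.isCountable T R).cosetGraphTrans
            ((𝒢.galoisLevelData h36).ker_piLevelAut_anti h36.isCountable hconn h)).branchMap (β' i') = β' i) →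
      (∀ (i : {i : ℕ // j₀ ≤ i}) (γ : C),
        (((𝒢.galoisLevelData h36).piPresentation h36.isCountable T R).arithAct hP
            ((𝒢.galoisLevelData h36).piLevelAut h36.isCountable hconn i.1).ker (hN i.1) (ι γ)).hom.vertexMap
            (w i) = w i ∧
        (((𝒢.galoisLevelData h36).piPresentation h36.isCountable T R).arithAct hP
            ((𝒢.galoisLevelData h36).piLevelAut h36.isCountable hconn i.1).ker (hN i.1) (ι γ)).hom.branchMap
            (β i) = β i ∧
        (((𝒢.galoisLevelData h36).piPresentation h36.isCountable T R).arithAct hP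
            ((𝒢.galoisLevelData h36).piLevelAut h36.isCountable hconn i.1).ker (hN i.1) (ι γ)).hom.branchMap
            (β' i) = β' i) → C = ⊥ :=
  hnobpNCpt_cosetTower h36 h37 hconn T R hP hN ι hιΦ hισ fun C hC j₀ w β β' hpair hcompat =>
    (𝒢.galoisLevelData h36).stabBranchPairCpt'_ofTower' h36.isCountable hconn (𝒢.temperedPiChart h36)
      (MonoidHom.id _) continuous_id Function.injective_id hfaithV C hC j₀ w β β' hpair hcompat

/-- **The capstone binder `hnobpNCpt` at the canonical coset tower — UNCONDITIONAL** (v2, appended): the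
vertex-faithfulness input (I0v) is abc-iut-L3-t6's THEOREM `galoisLevelData_faithfulV` (Thm 3.7 (i):
verticial homomorphisms are injective decomposition homomorphisms of point sequences), so under the hypotheses
of Thm 3.7 no compact `C ≠ 1` of `π₁^temp(𝒢)` fixes, through the arithmetic actions `arithAct hP (ker π_n) _ (ι γ)`,
a compatible system of a vertex with two distinct abutting branches of the coset semi-graphs `ker π_n` — the
binder `hnobpNCpt` of `ArithLevelDataCpt.ofCosetTowerC` at `𝒢.galoisLevelData h36`, `𝒢.temperedPiChart h36`,
`L n := ker π_n`, with NO residual input. [cite: MochizukiSemiAnbd2006, Thm 5.4 (i), p. 66] -/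
theorem hnobpNCpt_cosetTower_holds (h36 : 𝒢.Prop36Hypotheses) (h37 : 𝒢.Thm37Hypotheses)
    (hconn : ∀ (n : ℕ) (p q : ((𝒢.galoisLevelData h36).S n).Point),
      ((𝒢.galoisLevelData h36).S n).SameComponent p q)
    (T : ∀ w : 𝒢.graph.Vertex, (𝒢.galoisLevelData h36).PointSeq h36.isCountable w)
    (R : SemiGraph.RefBranches 𝒢.graph) {E : Type v} [Group E]
    {Φ : E →* MulAut (𝒢.temperedPiChart h36).G} {σ : E →* Aut 𝒢.graph}
    (hP : ((𝒢.galoisLevelData h36).piPresentation h36.isCountable T R).IsArithCompatible Φ σ)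
    (hN : ∀ (n : ℕ) (e : E) (x : (𝒢.temperedPiChart h36).G),
      x ∈ ((𝒢.galoisLevelData h36).piLevelAut h36.isCountable hconn n).ker →
        Φ e x ∈ ((𝒢.galoisLevelData h36).piLevelAut h36.isCountable hconn n).ker)
    (ι : (𝒢.temperedPiChart h36).G →* E) (hιΦ : ∀ g, Φ (ι g) = MulAut.conj g) (hισ : ∀ g, σ (ι g) = 1) :
    ∀ (C : Subgroup (𝒢.temperedPiChart h36).G), IsCompact (C : Set (𝒢.temperedPiChart h36).G) →
      ∀ (j₀ : ℕ) (w : ∀ i : {i : ℕ // j₀ ≤ i},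
        (((𝒢.galoisLevelData h36).piPresentation h36.isCountable T R).cosetGraph
          ((𝒢.galoisLevelData h36).piLevelAut h36.isCountable hconn i.1).ker).Vertex)
      (β β' : ∀ i : {i : ℕ // j₀ ≤ i},
        (((𝒢.galoisLevelData h36).piPresentation h36.isCountable T R).cosetGraph
          ((𝒢.galoisLevelData h36).piLevelAut h36.isCountable hconn i.1).ker).Branch),
      (∀ i, β i ≠ β' i ∧
        (((𝒢.galoisLevelData h36).piPresentation h36.isCountable T R).cosetGraph
          ((𝒢.galoisLevelData h36).piLevelAut h36.isCountable hconn i.1).ker).abuts (β i) = some (w i) ∧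
        (((𝒢.galoisLevelData h36).piPresentation h36.isCountable T R).cosetGraph
          ((𝒢.galoisLevelData h36).piLevelAut h36.isCountable hconn i.1).ker).abuts (β' i) = some (w i)) →
      (∀ ⦃i i' : {i : ℕ // j₀ ≤ i}⦄ (h : i.1 ≤ i'.1),
        (((𝒢.galoisLevelData h36).piPresentation h36.isCountable T R).cosetGraphTrans
            ((𝒢.galoisLevelData h36).ker_piLevelAut_anti h36.isCountable hconn h)).vertexMap (w i') = w i ∧
        (((𝒢.galoisLevelData h36).piPresentation h36.isCountable T R).cosetGraphTrans
            ((𝒢.galoisLevelData h36).ker_piLevelAut_anti h36.isCountable hconn h)).branchMap (β i') = β i ∧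
        (((𝒢.galoisLevelData h36).piPresentation h36.isCountable T R).cosetGraphTrans
            ((𝒢.galoisLevelData h36).ker_piLevelAut_anti h36.isCountable hconn h)).branchMap (β' i') = β' i) →
      (∀ (i : {i : ℕ // j₀ ≤ i}) (γ : C),
        (((𝒢.galoisLevelData h36).piPresentation h36.isCountable T R).arithAct hP
            ((𝒢.galoisLevelData h36).piLevelAut h36.isCountable hconn i.1).ker (hN i.1) (ι γ)).hom.vertexMap
            (w i) = w i ∧
        (((𝒢.galoisLevelData h36).piPresentation h36.isCountable T R).arithAct hP
            ((𝒢.galoisLevelData h36).piLevelAut h36.isCountable hconn i.1).ker (hN i.1) (ι γ)).hom.branchMap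
            (β i) = β i ∧
        (((𝒢.galoisLevelData h36).piPresentation h36.isCountable T R).arithAct hP
            ((𝒢.galoisLevelData h36).piLevelAut h36.isCountable hconn i.1).ker (hN i.1) (ι γ)).hom.branchMap
            (β' i) = β' i) → C = ⊥ :=
  hnobpNCpt_cosetTower_of_faithV h36 h37 hconn T R hP hN ι hιΦ hισ
    fun v h hfix => galoisLevelData_faithfulV 𝒢 h37 v h hfix

end ProfiniteSemiGraph

end Literature.AnabelianGeometry.SemiGraphs
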